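import Summits.BirchSwinnertonDyer.BirchSwinnertonDyer.Theorems.EisensteinPrimesFullDescentKummerSplitting
import Summits.BirchSwinnertonDyer.BirchSwinnertonDyer.Theorems.EisensteinPrimesFullDescentTateBasis
import Summits.BirchSwinnertonDyer.BirchSwinnertonDyer.Theorems.EisensteinPrimesFullDescentTateAlgebraNine
import Summits.BirchSwinnertonDyer.BirchSwinnertonDyer.Theorems.EisensteinPrimesFullDescentOrdinaryKernelRat
import Summits.BirchSwinnertonDyer.BirchSwinnertonDyer.Theorems.EisensteinPrimesLinePsiAtMultiplicativePrime
import Literature.NumberTheory.EllipticCurves.PrimaryTorsionLocalGoodReductionFrobeniusProofs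
import Literature.NumberTheory.EllipticCurves.OpenImageMazurProofs
import Literature.NumberTheory.EllipticCurves.PointDivisibilityProofs
import Literature.NumberTheory.GaloisCohomology.CyclotomicCharacterPPrimary
import Literature.NumberTheory.GaloisRepresentations.DecompositionGroupOfCompletion
import HarnessLib

/-!
# Route `EisensteinPrimes`, crux 2 `GoodLatticeBDPValue` (stmt-BirchSwinnertonDyer-19032), line `halves` v21 —
# stub 3a-B (Theorem T′), brick F7 first half: **THEOREM A-I — from the `ω`-line `C` to a rational cyclic group of
# order `9` over `C`**

Cell `bsd-eis` (home `run/shared/lean/pub/bsd-eis/`), LEAD seat `bsd-line-x1-p1` (gen 5; `--supports -19032`, closes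
nothing by itself). First half of the piece `hA` (Theorem A, Case `ω` ⇒ ⊥) of the LEAD's assembly
`FullDescentAssembly.fullDescentAtThreeOfRed_of_pieces` (road memo `HOME/line-x1-p1-w3-g4/AN3-StubB-elementary-road.md`,
§2 CASE ω, steps A1–A2): for `E/ℚ` with good ORDINARY reduction at `3`, every finite place `v ∤ 3` good or SPLIT
multiplicative with residue characteristic `≡ 2 (mod 3)`, and a point `Q ≠ 0` of `E[3]` on which `Γ_ℚ` acts through `χ̄₃`
(`C = ⟨Q⟩` the `ω`-line), there is a `Γ_ℚ`-STABLE subgroup `B ≤ E[9]` of order `9` with `B ∩ E[3] = C` (hence cyclic):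
the extension `M = 3⁻¹C / C` of `ω` by `𝟙` splits. Assembly of landed bricks, exactly parallel to Theorem B
(`FullDescentTheoremB`):

* A1/A2 at a split `ℓ ≡ 2 (mod 3)`: the level-`9` Tate basis (w3 gen 4, `exists_tateBasis_geomPoints_of_hasSplit…` at
  `N = 9`), `basis_three_of_basis_nine`, (T-f) `eq_zmultiples_fst_of_smul_eq_chi_three` (`C = ⟨3P₁'⟩`, a Frobenius having
  `χ̄₉ = ℓ ≢ 1 (mod 3)`) and (T-d) `smul_sub_mem_zmultiples_of_nine` (inertia, `χ̄₉ = 1`, is trivial on `3⁻¹C/C`);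
  Néron–Ogg–Shafarevich on `E[9]` at the good places;
* A2 at `3`: w4 gen 6's ordinary kernels `Λ ≤ K₂` (`Rat.exists_ordinary_reduction_kernels_of_hasGoodReductionAtPrime`):
  `C = Λ` (inertia has `χ̄₃ = −1` somewhere and is trivial on `E[3]/Λ`), so `K₂` is a decomposition-stable complement;
* the Kummer splitting lemma (w2 gen 5, `FullDescentKummerSplitting.exists_stable_complement`, unconditional) at
  `(L, N, M) = (C, E[3], 3⁻¹C)` in `V = E(ℚ̄)`, `c = 3` (`#3⁻¹C = 27`: `x ↦ 3x` maps `3⁻¹C` onto `C` with kernel `E[3]`,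
  points of `E(ℚ̄)` being `3`-divisible, `zsmul_geomPoints_surjective_holds`); the order of the complement `B` is `9` by
  the second isomorphism theorem (`B/(B ∩ E[3]) ≅ (B + E[3])/E[3] = 3⁻¹C/E[3]`).

HONEST FRAMING: helper theorems only (0 definitions, 0 named facts, 0 sorry); Theorem A still needs its second half
(`B ⟹ ⊥`: `χ_B = χ̄₉` by (G-ℚ), then `Γ_ℚ` trivial on `E[9]/B`, impossible at `3`); no summit statement, no BSD / IMC /
Keller–Yin theorem and no stub of the registered skeleton is proved by this file alone. References: [Kriz2016] Thm. 34;
[SilvermanATAEC1994] V.3.1, Lemma V.5.2, Thm. V.5.3; [SilvermanAEC2009] VII.4.1, VIII §2; [Serre1972] §1.11 Prop. 11;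
[Mazur1978] §5; [NeukirchANT1999] II §9 (9.6).
-/

set_option autoImplicit false

-- the route's Theorems namespace repeats the summit name by design (D-0017 nested layout)
set_option linter.dupNamespace false

noncomputable section

open scoped Classical NumberField

namespace Summit.BirchSwinnertonDyer.BirchSwinnertonDyer.Theorems.FullDescentTheoremA

open NumberField IsDedekindDomain Field WeierstrassCurve Rat.HeightOneSpectrum
  Literature.NumberTheory.EllipticCurves Literature.NumberTheory.GaloisRepresentations
  Summit.BirchSwinnertonDyer.BirchSwinnertonDyer.Theorems

variable (W : WeierstrassCurve ℚ) [W.IsElliptic]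

/-! ## §1. The `ω`-line `C = ⟨Q⟩` in `E(ℚ̄)`: stability, `Γ_ℚ` trivial on `E[3]/C`, the module `3⁻¹C` -/

omit [W.IsElliptic] in
/-- On `C = ⟨Q⟩`, `σ` acts as the scalar `χ̄₃(σ)`: `σ (k Q) = χ̄₃(σ) (k Q)`. [folklore] -/
theorem smul_eq_chi_smul_of_mem_zmultiples {Q : geomTorsion W ((3 : ℕ) : ℤ)}
    (hQ : ∀ σ : absoluteGaloisGroup ℚ, σ • Q = ((modNCyclotomicCharacter ℚ 3 σ : (ZMod 3)ˣ) : ZMod 3).val • Q)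
    (σ : absoluteGaloisGroup ℚ) {x : geomPoints W} (hx : x ∈ AddSubgroup.zmultiples (Q : geomPoints W)) :
    σ • x = (((modNCyclotomicCharacter ℚ 3 σ : (ZMod 3)ˣ) : ZMod 3).val : ℤ) • x := by
  obtain ⟨k, rfl⟩ := AddSubgroup.mem_zmultiples_iff.mp hx
  have hQc : σ • (Q : geomPoints W) = ((modNCyclotomicCharacter ℚ 3 σ : (ZMod 3)ˣ) : ZMod 3).val • (Q : geomPoints W) := by
    rw [← AddSubgroup.torsionBy.coe_smul, hQ σ, AddSubgroupClass.coe_nsmul]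
  rw [FullDescentTateAlgebra.smul_zsmul_comm, hQc, smul_comm, natCast_zsmul]

/-- For the `ω`-point `Q ≠ 0` and every `x ∈ E[3]`: `σ x − x ∈ ⟨Q⟩` (the shape `(χ̄₃ *; 0 𝟙)`: `det = χ̄₃`).
[cite: Mazur1978, §5 (p. 148) and §6 proof of Prop. 6.3 (p. 153)] -/
theorem smul_sub_mem_zmultiples_of_omega {Q : geomTorsion W ((3 : ℕ) : ℤ)} (hQ0 : Q ≠ 0)
    (hQ : ∀ σ : absoluteGaloisGroup ℚ, σ • Q = ((modNCyclotomicCharacter ℚ 3 σ : (ZMod 3)ˣ) : ZMod 3).val • Q)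
    (σ : absoluteGaloisGroup ℚ) {x : geomPoints W} (hx : x ∈ geomTorsion W ((3 : ℕ) : ℤ)) :
    σ • x - x ∈ AddSubgroup.zmultiples (Q : geomPoints W) := by
  haveI : Fact (Nat.Prime 3) := ⟨Nat.prime_three⟩
  have h := Mazur1978.smul_sub_smul_mem_zmultiples_of_isogenyCharacter W 3 hQ0
    (r := modNCyclotomicCharacter ℚ 3) hQ σ ⟨x, hx⟩
  rw [show modPCyclotomicCharacterZMod ℚ 3 = modNCyclotomicCharacter ℚ 3 from rfl, Units.mul_inv, ZMod.val_one,
    one_smul] at h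
  obtain ⟨k, hk⟩ := AddSubgroup.mem_zmultiples_iff.mp h
  refine AddSubgroup.mem_zmultiples_iff.mpr ⟨k, ?_⟩
  have hk' := congrArg (Subtype.val : geomTorsion W ((3 : ℕ) : ℤ) → geomPoints W) hk
  simp only [AddSubgroupClass.coe_sub, AddSubgroup.torsionBy.coe_smul] at hk'
  rw [hk']

omit [W.IsElliptic] in
/-- For `x` with `3x ∈ ⟨Q⟩`: `σ x − χ̄₃(σ) x ∈ E[3]` (`3⁻¹C/E[3] ≅ C` via `×3` carries `χ̄₃`). [folklore] -/
theorem smul_sub_chi_smul_mem_torsion {Q : geomTorsion W ((3 : ℕ) : ℤ)}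
    (hQ : ∀ σ : absoluteGaloisGroup ℚ, σ • Q = ((modNCyclotomicCharacter ℚ 3 σ : (ZMod 3)ˣ) : ZMod 3).val • Q)
    (σ : absoluteGaloisGroup ℚ) {x : geomPoints W}
    (hx : (3 : ℤ) • x ∈ AddSubgroup.zmultiples (Q : geomPoints W)) :
    σ • x - (((modNCyclotomicCharacter ℚ 3 σ : (ZMod 3)ˣ) : ZMod 3).val : ℤ) • x ∈ geomTorsion W ((3 : ℕ) : ℤ) := by
  rw [mem_torsionBy_iff, Nat.cast_ofNat, smul_sub, smul_comm (3 : ℤ) σ x, smul_smul, mul_comm, mul_smul,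
    smul_eq_chi_smul_of_mem_zmultiples W hQ σ hx, sub_self]

/-- **`#3⁻¹C = 27`** for a line `C = ⟨Q⟩ ≤ E[3]`: `x ↦ 3x` maps `3⁻¹C` ONTO `C` (points of `E(ℚ̄)` are `3`-divisible,
`zsmul_geomPoints_surjective_holds`) with kernel `E[3]` of order `9`. [cite: SilvermanAEC2009, Cor. III.6.4] -/
theorem natCard_comap_three {Q : geomTorsion W ((3 : ℕ) : ℤ)} (hQ0 : Q ≠ 0) :
    Nat.card ((AddSubgroup.zmultiples (Q : geomPoints W)).comap (zsmulAddGroupHom (3 : ℤ))) = 9 * 3 := by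
  haveI : Fact (Nat.Prime 3) := ⟨Nat.prime_three⟩
  set C : AddSubgroup (geomPoints W) := AddSubgroup.zmultiples (Q : geomPoints W) with hC
  set M : AddSubgroup (geomPoints W) := C.comap (zsmulAddGroupHom (3 : ℤ)) with hM
  -- the map `g = (3 •) : M → E(ℚ̄)`
  set g : M →+ geomPoints W := (zsmulAddGroupHom (3 : ℤ)).comp M.subtype with hg
  have hg_apply : ∀ x : M, g x = (3 : ℤ) • (x : geomPoints W) := fun x ↦ rfl
  -- its range is `C`
  have hrange : g.range = C := by
    apply le_antisymm
    · rintro _ ⟨x, rfl⟩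
      rw [hg_apply]
      exact (AddSubgroup.mem_comap.mp x.2)
    · intro c hc
      obtain ⟨x, hx⟩ := W.zsmul_geomPoints_surjective_holds (n := 3) (by norm_num) c
      have hxM : x ∈ M := by
        rw [hM, AddSubgroup.mem_comap, zsmulAddGroupHom_apply]
        simp only at hx
        rwa [hx]
      exact ⟨⟨x, hxM⟩, by rw [hg_apply]; exact hx⟩
  -- its kernel is `E[3]` (inside `M`)
  have hker : g.ker = (geomTorsion W ((3 : ℕ) : ℤ)).addSubgroupOf M := by
    ext x
    rw [AddMonoidHom.mem_ker, hg_apply, AddSubgroup.mem_addSubgroupOf, mem_torsionBy_iff, Nat.cast_ofNat]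
  have hE3M : geomTorsion W ((3 : ℕ) : ℤ) ≤ M := by
    intro x hx
    rw [hM, AddSubgroup.mem_comap, zsmulAddGroupHom_apply]
    rw [mem_torsionBy_iff, Nat.cast_ofNat] at hx
    rw [hx]
    exact C.zero_mem
  have h9 : Nat.card (geomTorsion W ((3 : ℕ) : ℤ)) = 9 := by
    rw [Literature.NumberTheory.EllipticCurves.natCard_geomTorsion W 3]; rfl
  have hcardker : Nat.card g.ker = 9 := by
    rw [hker, ← h9]
    exact Nat.card_congr (AddSubgroup.addSubgroupOfEquivOfLe hE3M).toEquiv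
  have hcardrange : Nat.card g.range = 3 := by
    rw [hrange, hC, Nat.card_zmultiples, AddSubgroup.addOrderOf_coe, addOrderOf_eq_of_ne_zero W 3 hQ0]
  rw [AddSubgroup.card_eq_card_quotient_mul_card_addSubgroup g.ker, hcardker,
    Nat.card_congr (QuotientAddGroup.quotientKerEquivRange g).toEquiv, hcardrange]

/-! ## §2. A1/A2 at a split multiplicative `ℓ ≡ 2 (mod 3)`: inertia is trivial on `3⁻¹C / C` -/

/-- **A1–A2 at a bad place.** `W/ℚ` split multiplicative at `v` with `ℓ_v ≡ 2 (mod 3)`, `Q ≠ 0` an `ω`-point of `E[3]`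
(`σ Q = χ̄₃(σ) Q`): for every `τ` in the local inertia group and every `x` with `3x ∈ ⟨Q⟩`, `res τ • x − x ∈ ⟨Q⟩`.
In the level-`9` Tate basis `(P₁', P₂')`: `⟨Q⟩ = ⟨3P₁'⟩` ((T-f): a Frobenius acts on `⟨Q⟩` and on `P₁'` through
`χ̄ = ℓ ≢ 1 (mod 3)`), and inertia (`χ̄₉ = 1`) moves `x` inside `⟨3P₁'⟩` ((T-d)).
[cite: SilvermanATAEC1994, Thm. V.3.1 (c),(d), Lemma V.5.2, Thm. V.5.3] [cite: NeukirchANT1999, Ch. I §10 (10.3), Ch. II §9 Prop. (9.6)] -/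
theorem smul_sub_mem_of_mem_absInertia_of_split_nine {v : HeightOneSpectrum (𝓞 ℚ)} (hv3 : natGenerator v ≠ 3)
    (hsplit : W.HasSplitMultiplicativeReductionAt v) (hmod : natGenerator v % 3 = 2)
    {Q : geomTorsion W ((3 : ℕ) : ℤ)} (hQ0 : Q ≠ 0)
    (hQ : ∀ σ : absoluteGaloisGroup ℚ, σ • Q = ((modNCyclotomicCharacter ℚ 3 σ : (ZMod 3)ˣ) : ZMod 3).val • Q)
    {τ : absoluteGaloisGroup (v.adicCompletion ℚ)} (hτ : τ ∈ absInertia (v.adicCompletion ℚ))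
    {x : geomPoints W} (hx : (3 : ℤ) • x ∈ AddSubgroup.zmultiples (Q : geomPoints W)) :
    absGaloisRestrict ℚ (v.adicCompletion ℚ) τ • x - x ∈ AddSubgroup.zmultiples (Q : geomPoints W) := by
  haveI : Fact (Nat.Prime 3) := ⟨Nat.prime_three⟩
  haveI hℓ : Fact (primesEquiv v : ℕ).Prime := ⟨(primesEquiv v).2⟩
  have hv : ((primesEquiv v : Nat.Primes) : ℕ) = natGenerator v := rfl
  -- the level-9 Tate basis
  obtain ⟨P₁, P₂, κ, -, -, hgen, hrel, hP₁, hP₂⟩ :=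
    FullDescentTateBasis.exists_tateBasis_geomPoints_of_hasSplitMultiplicativeReductionAt W v hsplit (N := 9)
  -- the composite action of `Γ_{ℚ_v}` on `E(ℚ̄)` through `res`
  letI inst : DistribMulAction (absoluteGaloisGroup (v.adicCompletion ℚ)) (geomPoints W) :=
    DistribMulAction.compHom _ (absGaloisRestrict ℚ (v.adicCompletion ℚ)).toMonoidHom
  have hdef : ∀ (σ : absoluteGaloisGroup (v.adicCompletion ℚ)) (y : geomPoints W),
      σ • y = absGaloisRestrict ℚ (v.adicCompletion ℚ) σ • y := fun _ _ ↦ rfl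
  set χ : absoluteGaloisGroup (v.adicCompletion ℚ) → ℤ := fun σ ↦
    (((modNCyclotomicCharacter ℚ 9 (absGaloisRestrict ℚ (v.adicCompletion ℚ) σ) : (ZMod 9)ˣ) : ZMod 9).val : ℤ)
    with hχ
  set κ' : absoluteGaloisGroup (v.adicCompletion ℚ) → ℤ := fun σ ↦ (κ σ : ℤ) with hκ'
  have hgen' : ∀ P : geomPoints W, (9 : ℤ) • P = 0 → ∃ a b : ℤ, P = a • P₁ + b • P₂ := fun P hP ↦
    hgen P (by simpa using hP)
  have hrel' : ∀ a b : ℤ, a • P₁ + b • P₂ = 0 ↔ (9 : ℤ) ∣ a ∧ (9 : ℤ) ∣ b := fun a b ↦ by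
    simpa using hrel a b
  have hP₁' : ∀ σ : absoluteGaloisGroup (v.adicCompletion ℚ), σ • P₁ = χ σ • P₁ := fun σ ↦ by
    rw [hdef, hP₁ σ, hχ, natCast_zsmul]
  have hP₂' : ∀ σ : absoluteGaloisGroup (v.adicCompletion ℚ), σ • P₂ = P₂ + κ' σ • P₁ := fun σ ↦ by
    rw [hdef, hP₂ σ, hκ', natCast_zsmul]
  obtain ⟨hgen3, hrel3, hP₁3, hP₂3⟩ := FullDescentTateAlgebra.basis_three_of_basis_nine hgen' hrel' hP₁' hP₂'
  -- a Frobenius: `χ̄₉(res σ₀) = ℓ`, `ℓ ≡ 2 (mod 3)`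
  obtain ⟨𝔐, h𝔐⟩ := v.localPrimesAbove_nonempty
  obtain ⟨σ₀, hσ₀⟩ := IsDedekindDomain.HeightOneSpectrum.exists_isArithFrobAt_localAbsIntegers v h𝔐
  have hℓ3 : ¬ natGenerator v ∣ 3 := fun h ↦
    hv3 ((Nat.prime_dvd_prime_iff_eq (prime_natGenerator v) Nat.prime_three).mp h)
  have hℓ9 : ¬ natGenerator v ∣ 9 := fun h ↦
    hℓ3 ((Nat.Prime.dvd_mul (prime_natGenerator v)).mp (by simpa using h) |>.elim id id)
  have hχσ₀ : χ σ₀ = ((natGenerator v % 9 : ℕ) : ℤ) := by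
    have h := EisensteinPrimesLinePsiAtMultiplicativePrime.modNCyclotomicCharacter_absGaloisRestrict_frob
      (p := natGenerator v) hv h𝔐 hσ₀ 9 hℓ9
    simp only [hχ]
    rw [h, ZMod.val_natCast]
  have hσ₀' : ¬ (3 : ℤ) ∣ χ σ₀ - 1 := by
    rw [hχσ₀]
    have h9 : natGenerator v % 9 % 3 = 2 := by rw [Nat.mod_mod_of_dvd _ (by norm_num : 3 ∣ 9)]; exact hmod
    omega
  -- `χ̄₃(res σ₀) = ℓ` too, so `σ₀` acts on `⟨Q⟩` as the scalar `χ σ₀`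
  have hχ3σ₀ : (((modNCyclotomicCharacter ℚ 3 (absGaloisRestrict ℚ (v.adicCompletion ℚ) σ₀) : (ZMod 3)ˣ) :
      ZMod 3).val : ℤ) = ((natGenerator v % 3 : ℕ) : ℤ) := by
    have h := EisensteinPrimesLinePsiAtMultiplicativePrime.modNCyclotomicCharacter_absGaloisRestrict_frob
      (p := natGenerator v) hv h𝔐 hσ₀ 3 hℓ3
    rw [h, ZMod.val_natCast]
  have hQ3 : (3 : ℤ) • (Q : geomPoints W) = 0 := by
    have h : ((3 : ℕ) : ℤ) • (Q : geomPoints W) = 0 := mem_torsionBy_iff.mp Q.2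
    exact_mod_cast h
  have hact : ∀ y ∈ AddSubgroup.zmultiples (Q : geomPoints W), σ₀ • y = χ σ₀ • y := by
    intro y hy
    rw [hdef, smul_eq_chi_smul_of_mem_zmultiples W hQ _ hy, hχ3σ₀, hχσ₀]
    -- `y` is `3`-torsion and `ℓ % 9 ≡ ℓ % 3 (mod 3)`
    obtain ⟨k, rfl⟩ := AddSubgroup.mem_zmultiples_iff.mp hy
    obtain ⟨t, ht⟩ : ∃ t : ℤ, ((natGenerator v % 9 : ℕ) : ℤ) = ((natGenerator v % 3 : ℕ) : ℤ) + 3 * t := by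
      refine ⟨(((natGenerator v % 9 : ℕ) : ℤ) - ((natGenerator v % 3 : ℕ) : ℤ)) / 3, ?_⟩
      have h1 : (natGenerator v % 9) % 3 = natGenerator v % 3 := Nat.mod_mod_of_dvd _ (by norm_num)
      omega
    have h3kQ : (3 : ℤ) • (k • (Q : geomPoints W)) = 0 := by rw [smul_comm, hQ3, smul_zero]
    rw [ht, add_smul, mul_comm (3 : ℤ) t, mul_smul, h3kQ, smul_zero, add_zero]
  -- (T-f): `⟨Q⟩ = ⟨3 P₁⟩`
  have hCcard : Nat.card (AddSubgroup.zmultiples (Q : geomPoints W)) = 3 := by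
    rw [Nat.card_zmultiples, AddSubgroup.addOrderOf_coe, addOrderOf_eq_of_ne_zero W 3 hQ0]
  have hC : AddSubgroup.zmultiples (Q : geomPoints W) = AddSubgroup.zmultiples ((3 : ℤ) • P₁) :=
    FullDescentTateAlgebra.eq_zmultiples_fst_of_smul_eq_chi_three hgen3 hrel3 hP₁3 hP₂3 hσ₀' hCcard hact
  -- inertia: `χ̄₉(res τ) = 1`
  have h9v : ((9 : ℕ) : 𝓞 ℚ) ∉ v.asIdeal := fun h ↦ hℓ9 ((Rat.natCast_mem_asIdeal_iff v).mp h)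
  haveI : NeZero ((9 : ℕ) : ℚ) := ⟨by norm_num⟩
  have hχτ : (9 : ℤ) ∣ χ τ - 1 := by
    have h := Literature.NumberTheory.GaloisCohomology.modNCyclotomicCharacter_absGaloisRestrict_eq_one_of_mem_absInertia
      ℚ 9 v h9v hτ
    simp only [hχ]
    rw [h, Units.val_one]
    have h1 : (1 : ZMod 9).val = 1 := rfl
    rw [h1]
    simp
  have hx9 : (9 : ℤ) • x = 0 := by
    obtain ⟨k, hk⟩ := AddSubgroup.mem_zmultiples_iff.mp hx
    rw [show (9 : ℤ) = 3 * 3 by norm_num, mul_smul, ← hk, smul_comm, hQ3, smul_zero]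
  have key := FullDescentTateAlgebra.smul_sub_mem_zmultiples_of_nine hgen' hrel' hP₁' hP₂' hχτ hx9 (hC ▸ hx)
  rw [hdef] at key
  rwa [hC]

/-! ## §3. Theorem A-I -/

/-- **Theorem A-I (AN-3 road, Case `ω`, steps A1–A2).** `W/ℚ` globally minimal with good ORDINARY reduction at `3`;
every finite place `v ∤ 3` good, or split multiplicative with residue characteristic `≡ 2 (mod 3)`; `Q ≠ 0` a point of
`E[3]` with `σ Q = χ̄₃(σ) Q`. Then there is a `Γ_ℚ`-stable subgroup `B ≤ E[9]` of order `9` containing `C = ⟨Q⟩` with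
`B ∩ E[3] = C` — i.e. `B` is CYCLIC of order `9` with `3B = C`: the sequence `0 → E[3]/C → 3⁻¹C/C → C → 0` splits over
`Γ_ℚ` (Kummer splitting `FullDescentKummerSplitting.exists_stable_complement` at `c = 3`, fed with
`smul_sub_mem_of_mem_absInertia_of_split_nine`, Néron–Ogg–Shafarevich, and Serre's ordinary kernels `C = Λ ≤ K₂` at `3`).
[cite: Kriz2016, Thm. 34 (2)–(3)] [cite: Serre1972, §1.11 Prop. 11] [cite: SilvermanAEC2009, VIII §2 (Kummer pairing)] -/
theorem exists_stable_nine_of_omega_point [W.IsGloballyMinimal]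
    (h3 : W.HasGoodReductionAtPrime 3) (hord : ¬ (3 : ℤ) ∣ W.frobeniusTrace 3)
    (hH : ∀ v : HeightOneSpectrum (𝓞 ℚ), natGenerator v ≠ 3 →
      W.HasGoodReductionAt v ∨ (W.HasSplitMultiplicativeReductionAt v ∧ natGenerator v % 3 = 2))
    (Q : geomTorsion W ((3 : ℕ) : ℤ)) (hQ0 : Q ≠ 0)
    (hQ : ∀ σ : absoluteGaloisGroup ℚ, σ • Q = ((modNCyclotomicCharacter ℚ 3 σ : (ZMod 3)ˣ) : ZMod 3).val • Q) :
    ∃ B : AddSubgroup (geomPoints W),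
      AddSubgroup.zmultiples (Q : geomPoints W) ≤ B ∧ B ≤ geomTorsion W ((9 : ℕ) : ℤ) ∧ Nat.card B = 9 ∧
      B ⊓ geomTorsion W ((3 : ℕ) : ℤ) = AddSubgroup.zmultiples (Q : geomPoints W) ∧
      ∀ σ : absoluteGaloisGroup ℚ, ∀ x ∈ B, σ • x ∈ B := by
  haveI : Fact (Nat.Prime 3) := ⟨Nat.prime_three⟩
  -- notation-free abbreviations
  have hQ0' : (Q : geomPoints W) ≠ 0 := fun h ↦ hQ0 (Subtype.ext h)
  have hQM : (Q : geomPoints W) ∈ geomTorsion W ((3 : ℕ) : ℤ) := Q.2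
  have hQ3 : (3 : ℤ) • (Q : geomPoints W) = 0 := by
    have h : ((3 : ℕ) : ℤ) • (Q : geomPoints W) = 0 := mem_torsionBy_iff.mp Q.2
    exact_mod_cast h
  have hCN : AddSubgroup.zmultiples (Q : geomPoints W) ≤ geomTorsion W ((3 : ℕ) : ℤ) :=
    AddSubgroup.zmultiples_le_of_mem hQM
  have hNM : geomTorsion W ((3 : ℕ) : ℤ) ≤ (AddSubgroup.zmultiples (Q : geomPoints W)).comap (zsmulAddGroupHom (3 : ℤ)) := by
    intro x hx
    rw [AddSubgroup.mem_comap, zsmulAddGroupHom_apply]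
    rw [mem_torsionBy_iff, Nat.cast_ofNat] at hx
    rw [hx]
    exact AddSubgroup.zero_mem _
  have hM9 : (AddSubgroup.zmultiples (Q : geomPoints W)).comap (zsmulAddGroupHom (3 : ℤ)) ≤
      geomTorsion W ((9 : ℕ) : ℤ) := by
    intro x hx
    rw [AddSubgroup.mem_comap, zsmulAddGroupHom_apply] at hx
    obtain ⟨k, hk⟩ := AddSubgroup.mem_zmultiples_iff.mp hx
    rw [mem_torsionBy_iff, Nat.cast_ofNat, show (9 : ℤ) = 3 * 3 by norm_num, mul_smul, ← hk, smul_comm, hQ3,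
      smul_zero]
  -- cardinalities
  have hcC : Nat.card (AddSubgroup.zmultiples (Q : geomPoints W)) = 3 := by
    rw [Nat.card_zmultiples, AddSubgroup.addOrderOf_coe, addOrderOf_eq_of_ne_zero W 3 hQ0]
  have hcN : Nat.card (geomTorsion W ((3 : ℕ) : ℤ)) = 3 * 3 := by
    rw [Literature.NumberTheory.EllipticCurves.natCard_geomTorsion W 3]; rfl
  have hcM := natCard_comap_three W hQ0
  -- the place above `3`; `C = Λ ≤ K₂`
  obtain ⟨v₃, hv₃'⟩ : ∃ v₃ : HeightOneSpectrum (𝓞 ℚ), primesEquiv v₃ = ⟨3, Nat.prime_three⟩ :=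
    ⟨(primesEquiv (R := 𝓞 ℚ)).symm ⟨3, Nat.prime_three⟩, Equiv.apply_symm_apply _ _⟩
  have hv₃ : natGenerator v₃ = 3 := congrArg Subtype.val hv₃'
  have h3v₃ : ((3 : ℕ) : 𝓞 ℚ) ∈ v₃.asIdeal := (Rat.natCast_mem_asIdeal_iff v₃).mpr (hv₃ ▸ dvd_refl _)
  obtain ⟨Λ, K₂, hΛle, hΛcard, hK₂le, hK₂card, hK₂inf, hΛst, hK₂st, hΛquot, -, -, hΛχ, -⟩ :=
    FullDescentOrdinaryNine.Rat.exists_ordinary_reduction_kernels_of_hasGoodReductionAtPrime W 3 (by norm_num) h3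
      hord v₃ h3v₃
  have hCΛ : AddSubgroup.zmultiples (Q : geomPoints W) = Λ := by
    -- `Q ∈ Λ`: `τ₀ Q − Q = 2Q − Q = Q ∈ Λ` for `τ₀ ∈ I₃` with `χ̄₃(res τ₀) = −1`
    obtain ⟨τ, hτ, hτχ⟩ :=
      FullDescentOrdinaryNine.Rat.exists_mem_absInertia_modNCyclotomicCharacter_absGaloisRestrict_eq 3 v₃ h3v₃ (-1)
    have hQΛ : (Q : geomPoints W) ∈ Λ := by
      have h := hΛquot τ hτ (Q : geomPoints W) hQM
      have hQc : absGaloisRestrict ℚ (v₃.adicCompletion ℚ) τ • (Q : geomPoints W) = (2 : ℕ) • (Q : geomPoints W) := by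
        rw [← AddSubgroup.torsionBy.coe_smul, hQ, hτχ, AddSubgroupClass.coe_nsmul]
        rfl
      rwa [hQc, two_nsmul, add_sub_cancel_right] at h
    haveI : Finite Λ := Nat.finite_of_card_ne_zero (by rw [hΛcard]; norm_num)
    exact AddSubgroup.eq_of_le_of_card_ge (AddSubgroup.zmultiples_le_of_mem hQΛ) (by rw [hΛcard, hcC])
  -- the Kummer splitting lemma at `(C, E[3], 3⁻¹C)`
  obtain ⟨B, hCB, hBM, hBN, hNB, hBst⟩ := FullDescentKummerSplitting.exists_stable_complement (V := geomPoints W)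
    (AddSubgroup.zmultiples (Q : geomPoints W)) (geomTorsion W ((3 : ℕ) : ℤ))
    ((AddSubgroup.zmultiples (Q : geomPoints W)).comap (zsmulAddGroupHom (3 : ℤ))) hCN hNM
    (by norm_num : (3 : ℕ) ≠ 0) hcC hcN hcM
    (fun σ x hx ↦ by
      obtain ⟨k, rfl⟩ := AddSubgroup.mem_zmultiples_iff.mp hx
      rw [FullDescentTateAlgebra.smul_zsmul_comm]
      exact AddSubgroup.zsmul_mem _ (by
        rw [← AddSubgroup.torsionBy.coe_smul, hQ σ, AddSubgroupClass.coe_nsmul]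
        exact AddSubgroup.nsmul_mem _ (AddSubgroup.mem_zmultiples _) _) _)
    (fun x hx ↦ by rw [AddSubgroup.mem_comap, zsmulAddGroupHom_apply] at hx; exact hx)
    (fun σ x hx ↦ smul_sub_mem_zmultiples_of_omega W hQ0 hQ σ hx)
    (fun σ x hx ↦ smul_sub_chi_smul_mem_torsion W hQ σ (by
      rw [AddSubgroup.mem_comap, zsmulAddGroupHom_apply] at hx; exact hx))
    (fun x _ ↦ W.isOpen_stabilizer_point_holds x)
    (fun v hv ↦ by
      refine ⟨adicCompletionPrime ℚ v, adicCompletionPrime_mem_primesAbove ℚ v, fun τ hτ x hx ↦ ?_⟩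
      rw [inertia_adicCompletionPrime_eq_map_absInertia ℚ v] at hτ
      obtain ⟨τ', hτ', rfl⟩ := Subgroup.mem_map.mp hτ
      have hx' : (3 : ℤ) • x ∈ AddSubgroup.zmultiples (Q : geomPoints W) := by
        rw [AddSubgroup.mem_comap, zsmulAddGroupHom_apply] at hx; exact hx
      rcases hH v hv with hgood | ⟨hsplit, hmod⟩
      · have hn : ((((9 : ℕ) : ℤ)) : 𝓞 ℚ) ∉ v.asIdeal := by
          rw [Int.cast_natCast]
          intro h
          have h9 := (Rat.natCast_mem_asIdeal_iff v).mp h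
          have h3 : natGenerator v ∣ 3 :=
            ((Nat.Prime.dvd_mul (prime_natGenerator v)).mp (by simpa using h9)).elim id id
          exact hv ((Nat.prime_dvd_prime_iff_eq (prime_natGenerator v) Nat.prime_three).mp h3)
        have hx9 : ((9 : ℕ) : ℤ) • x = 0 := mem_torsionBy_iff.mp (hM9 hx)
        have h := W.smul_eq_of_mem_absInertia_of_hasGoodReductionAt hgood hn hτ' hx9
        rw [show (absGaloisRestrict ℚ (v.adicCompletion ℚ)).toMonoidHom τ' • x = x from h, sub_self]
        exact AddSubgroup.zero_mem _
      · exact smul_sub_mem_of_mem_absInertia_of_split_nine W hv hsplit hmod hQ0 hQ hτ' hx')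
    hv₃
    ⟨K₂, by rw [hCΛ, ← hK₂inf]; exact inf_le_left, fun x hx ↦ by
        rw [AddSubgroup.mem_comap, zsmulAddGroupHom_apply, hCΛ, ← hK₂inf]
        refine AddSubgroup.mem_inf.mpr ⟨K₂.zsmul_mem hx 3, ?_⟩
        have hx9 : ((9 : ℕ) : ℤ) • x = 0 := mem_torsionBy_iff.mp (hK₂le hx)
        rw [mem_torsionBy_iff, Nat.cast_ofNat, smul_smul]
        simpa using hx9,
      by rw [hK₂card]; rfl, by rw [hK₂inf, hCΛ], fun δ hδ x hx ↦ by
        obtain ⟨σ, rfl⟩ := (GreenbergSelmer.mem_decomp_iff v₃ δ).mp hδ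
        exact hK₂st σ x hx⟩
  -- `#B = 9` by the second isomorphism theorem: `B/(B ⊓ E[3]) ≅ (B ⊔ E[3])/E[3] = 3⁻¹C/E[3]`
  refine ⟨B, hCB, hBM.trans hM9, ?_, hBN, hBst⟩
  have hq : Nat.card (B ⧸ (geomTorsion W ((3 : ℕ) : ℤ)).addSubgroupOf B) =
      Nat.card (↥(B ⊔ geomTorsion W ((3 : ℕ) : ℤ)) ⧸
        (geomTorsion W ((3 : ℕ) : ℤ)).addSubgroupOf (B ⊔ geomTorsion W ((3 : ℕ) : ℤ))) :=
    Nat.card_congr (QuotientAddGroup.quotientInfEquivSumNormalQuotient B (geomTorsion W ((3 : ℕ) : ℤ))).toEquiv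
  have hinB : Nat.card ((geomTorsion W ((3 : ℕ) : ℤ)).addSubgroupOf B) = 3 := by
    rw [← AddSubgroup.inf_addSubgroupOf_right,
      Nat.card_congr (AddSubgroup.addSubgroupOfEquivOfLe (inf_le_right : geomTorsion W ((3 : ℕ) : ℤ) ⊓ B ≤ B)).toEquiv,
      inf_comm, hBN, hcC]
  have hinBN : Nat.card ((geomTorsion W ((3 : ℕ) : ℤ)).addSubgroupOf (B ⊔ geomTorsion W ((3 : ℕ) : ℤ))) = 3 * 3 := by
    rw [Nat.card_congr (AddSubgroup.addSubgroupOfEquivOfLe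
      (le_sup_right : geomTorsion W ((3 : ℕ) : ℤ) ≤ B ⊔ geomTorsion W ((3 : ℕ) : ℤ))).toEquiv, hcN]
  have h1 := AddSubgroup.card_eq_card_quotient_mul_card_addSubgroup ((geomTorsion W ((3 : ℕ) : ℤ)).addSubgroupOf B)
  have h2 := AddSubgroup.card_eq_card_quotient_mul_card_addSubgroup
    ((geomTorsion W ((3 : ℕ) : ℤ)).addSubgroupOf (B ⊔ geomTorsion W ((3 : ℕ) : ℤ)))
  have hBN27 : Nat.card ↥(B ⊔ geomTorsion W ((3 : ℕ) : ℤ)) = 9 * 3 := by rw [sup_comm, hNB, hcM]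
  rw [hinB, hq] at h1
  rw [hinBN, hBN27] at h2
  rw [h1]
  omega

end Summit.BirchSwinnertonDyer.BirchSwinnertonDyer.Theorems.FullDescentTheoremA

end
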